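/-
Copyright: the b2b-balaban T⁴-continuum CRUX team, row NE7b OWNER lineage `t4-ne7b-p1` (gen 124). Project licence.
-/
import Summits.QuantumFields.BalabanUV.T4Continuum.Spine.NE7b.SupZdPerturbedOperator
import Summits.QuantumFields.BalabanUV.T4Continuum.Spine.NE7b.SupZdProfileNoLoss
import Mathlib.Analysis.Normed.Ring.InfiniteSum

/-!
# THE `H + K` COLUMN ON `ℤ^d`, DECAY: for `V : ℤ^d → [−λ, Λ]` (`d ≥ 3`, every mesh) and a kernel `|K(p,q)| ≤ εe^{−γ|p − q|₁}` small in the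
# sense of (213) AND of the profile contraction `(C_PK_{δ₀−μ})·εe^{μd}K_{γ−μ} ≤ 1∕2` (`0 < μ < min(δ₀, γ)`), every bounded solution of
# `(H_V + K)u = f` with `f` supported in the block `b₀`, `|f| ≤ M`, satisfies `|u(p)| ≤ 2C_PK_{δ₀−μ}·M·e^{−μ|blk n p − b₀|₁}` — the Neumann
# iterates `u_j = (−H_V⁻¹K)^jH_V⁻¹f` keep the profile with ratio `≤ 1∕2` ((214)'s NO-LOSS profile lemma + the kernel step), their series solves
# the perturbed equation (stencil and kernel rows through `Σ_j`: Tannery∕Fubini on `ℕ × ℤ^d`) and is THE bounded solution ((213)); constants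
# from `(d, a, λ, Λ)` ONLY.  With (213) the `H + K` column has an infinite-volume OBJECT with exponential block-scale decay (row NE7b, node U5c;
# (188)∕(189)∕(213)∕(214) BY NAME; [folklore])

Cell `pub-balaban`, sub-cell `t4`, spine estimate NE7b (`T4WeightBudget.RelWeightBound`; the cell's OWN estimate — NOT PRINTED in
[Bałaban 1983–89], NOT PROVED).  Crux-route work under `Spine/NE7b/` by the row OWNER (`t4-ne7b-p1` gen 124, file (215)) under FREEZE
(0)'s crux-prover clause; NOTHING of Bałaban's is named as a Lean object, valued or asserted; no `T4Continuum/Support` leaf typed; no `def`,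
no notation (the iterates WRITTEN OUT as `((−(G∘K_op))^j)(Gf)` for (188)'s `G` and (203)'s kernel operator; everything else displayed);
zero `sorry`.  Imports (BY NAME): the OWNER's (213) `…SupZdPerturbedOperator` (`zd_perturbed_inverse_clm`; through it (203) `kernel_clm`,
(188) `exists_zd_propagator_clm`, (189) `summable_exp_l1`, `tsum_exp_l1_le`, (48) `abs_apply_le_norm`), (214) `…SupZdProfileNoLoss`
(`zd_profile_noLoss`, (194) `l1_triangle`), (179) `abs_le_side_mul`, Mathlib's `Summable.mul_of_nonneg` (`Analysis.Normed.Ring.InfiniteSum`),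
`Summable.tsum_comm`, `Summable.tsum_eq_zero_add`, `summable_geometric_of_lt_one`, `tsum_geometric_of_lt_one`.

WHY (located).  § [NE7bP1-G124-HANDOFF] NEXT (3)(a) and its recorded obstacle: (213) inverted `H_V + K` on `ℓ^∞(ℤ^d)` without decay,
and a Neumann iteration through (182)'s profile lemma loses half the rate per step.  (214) removed the obstacle (rate `μ < δ₀` is
preserved exactly), and the kernel step preserves it too: `|Σ′_qK(p,q)v(q)| ≤ εe^{μd}K_{γ−μ}B·e^{−μ|blk n p − b₀|₁}` for `|v| ≤ Be^{−μ|blk n · −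
b₀|₁}` (triangle on blocks, `|blk p − blk q|₁ ≤ |p − q|₁ + d`).  Hence `|u_j| ≤ C_PKMθ^je^{−μρ}` with `θ ≤ 1∕2`, the series converges with the
profile, and it solves the equation: `H_Vu₀ = f`, `H_Vu_{j+1} = −Ku_j` ((188)'s display), the finite stencil passes through `Σ_j`
(absolute convergence), the kernel rows pass through `Σ_j` (Fubini on `ℕ × ℤ^d` under `Bθ^j·εe^{−γ|q−q′|₁}`), and `Σ_j = u₀ + Σ_ju_{j+1}`;
(213)'s uniqueness identifies every bounded solution with it.

WHAT IS PROVED ([folklore]): §1 `blockDist_le_l1`, **`kernel_profile_step`**; §2 **`neumann_iterates_profile`** (the iterates keep the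
profile, given a no-loss profile bound for `G` as hypothesis); §3 **`neumann_series_solves`** (series of iterates with geometric profile
bounds and the recursion: summable, profile `2B`, solves `H_Vu + Σ′K(·,q)u(q) = f`); §4 **`zd_perturbed_decay`** (THE END: `∃ C₀ C_P δ₀ > 0`:
for ALL `n, V`, `ε ≥ 0`, `0 < μ < min(δ₀,γ)`, the two smallness conditions, every `K` of the class, block source `f` (`|f| ≤ M`) and bounded
solution `u`: `|u(p)| ≤ 2C_PK_{δ₀−μ}Me^{−μ|blk n p − b₀|₁}`); §5 toy.

HONEST (what this is NOT).  Block sources (general profile sources and the perturbed coarse operator `Q′G_KQ′*` ∕ its inverse on `ℤ^d` are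
the sequel, by (194)'s section method); TWO smallness conditions with the sup road's constants — NOT (163)'s energy threshold; symmetry of
`K` unused; the LINEAR column only; `d ≥ 3` only; scalar skeleton ((A3), NC-NE7b-α UNRULED); nothing of the covariant propagators of
[B4]–[B6]; nothing of Bałaban's asserted.  BY-NAME EFFECT ON THE WALL: NONE.  NE7b NOT PRINTED ∕ NOT PROVED; spine PROVED 0∕9; rung (B)+1 —
the programme's measures remain FINITE-torus statements; NOT the mass gap, NOT Clay.  HONEST DEPENDENCY: continuum YM on T⁴ ⇐ BetaPertH ∧
nine spine estimates (0∕9 proved); BetaPertH ⇐ (D1) ∧ (D4) ∧ CAP+tail; G-an2-4 gates asym, D1 and NE2∕3∕4.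
-/

set_option autoImplicit false

noncomputable section

namespace Summit.QuantumFields.BalabanUV.T4Continuum.NE7b.SupZdPerturbedDecay

open Real Filter Topology
open scoped ENNReal
open Literature.MathematicalPhysics.QuantumFieldTheory.Balaban1983to89
open B6QGQLower276 (X e blk B side chart mem_B sum_B sum_B_const card_cube blk_chart)
open SupTorusTowerComparison (abs_le_side_mul)
open SupZdExponentialSums (summable_exp_l1 tsum_exp_l1_le)
open SupZdCoarseInverse (l1_triangle)
open SupZdCoarseInverseOperator (kernel_clm)
open SupZdPropagatorOperator (exists_zd_propagator_clm)
open SupZdPerturbedOperator (zd_perturbed_inverse_clm)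
open SupZdProfileNoLoss (zd_profile_noLoss)
open OneShotChartSupOperator (abs_apply_le_norm)

variable {d : ℕ}

/-! ## §1. Block distances under fine distances; the kernel step of the iteration -/

/-- `|blk n p − blk n q|₁ ≤ |p − q|₁ + d` (coordinatewise `(n+1)|Δblk| ≤ |Δp| + n`). [folklore] -/
theorem blockDist_le_l1 (n : ℕ) (p q : X d) :
    ∑ i, (((blk n p i - blk n q i).natAbs : ℕ) : ℝ) ≤ ∑ i, (((p i - q i).natAbs : ℕ) : ℝ) + d := by
  have hcoord : ∀ i, (((blk n p i - blk n q i).natAbs : ℕ) : ℝ) ≤ (((p i - q i).natAbs : ℕ) : ℝ) + 1 := by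
    intro i
    obtain ⟨-, hr0, hr1, hp⟩ := abs_le_side_mul n p i
    obtain ⟨-, hs0, hs1, hq⟩ := abs_le_side_mul n q i
    set rp : ℤ := p i % side n with hrp
    set rq : ℤ := q i % side n with hrq
    have hside : side n = (n : ℤ) + 1 := rfl
    have e1 : side n * (blk n p i - blk n q i) = (p i - q i) - (rp - rq) := by rw [hp, hq]; ring
    have h1 : ((n : ℤ) + 1) * |blk n p i - blk n q i| ≤ |p i - q i| + n := by
      have h2 : |side n * (blk n p i - blk n q i)| ≤ |p i - q i| + |rp - rq| := by rw [e1]; exact abs_sub _ _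
      rw [abs_mul, hside, abs_of_nonneg (by positivity : (0 : ℤ) ≤ (n : ℤ) + 1)] at h2
      have : |rp - rq| ≤ n := by rw [hside] at hr1 hs1; rw [abs_le]; constructor <;> linarith
      linarith
    -- `(n+1)x ≤ y + n` with integers `x ≥ 0`, `y ≥ 0` ⟹ `x ≤ y + 1`
    have hx0 : 0 ≤ |blk n p i - blk n q i| := abs_nonneg _
    have hy0 : 0 ≤ |p i - q i| := abs_nonneg _
    have h3 : |blk n p i - blk n q i| ≤ |p i - q i| + 1 := by nlinarith
    rw [← Int.natCast_natAbs, ← Int.natCast_natAbs] at h3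
    exact_mod_cast h3
  calc ∑ i, (((blk n p i - blk n q i).natAbs : ℕ) : ℝ) ≤ ∑ i, ((((p i - q i).natAbs : ℕ) : ℝ) + 1) := Finset.sum_le_sum fun i _ => hcoord i
    _ = ∑ i, (((p i - q i).natAbs : ℕ) : ℝ) + d := by rw [Finset.sum_add_distrib]; simp

/-- **THE KERNEL STEP**: `|K(p,q)| ≤ εe^{−γ|p−q|₁}`, `|v(q)| ≤ Be^{−μ|blk n q − b₀|₁}`, `0 ≤ μ < γ` ⟹ the row series converges and
`|Σ′_qK(p,q)v(q)| ≤ ε·e^{μd}·K_{γ−μ}·B·e^{−μ|blk n p − b₀|₁}` — triangle on blocks and `|blk p − blk q|₁ ≤ |p − q|₁ + d`. [folklore] -/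
theorem kernel_profile_step (n : ℕ) {ε γ μ Bv : ℝ} (hε : 0 ≤ ε) (hμ : 0 ≤ μ) (hμγ : μ < γ) (K : X d → X d → ℝ)
    (hK : ∀ p q, |K p q| ≤ ε * exp (-(γ * ∑ i, (((p i - q i).natAbs : ℕ) : ℝ)))) (b₀ : X d) (v : X d → ℝ)
    (hv : ∀ q, |v q| ≤ Bv * exp (-(μ * ∑ i, (((blk n q i - b₀ i).natAbs : ℕ) : ℝ)))) (p : X d) :
    Summable (fun q : X d => K p q * v q) ∧
    |∑' q : X d, K p q * v q| ≤ ε * exp (μ * d) * (2 * (1 - exp (-(γ - μ)))⁻¹) ^ d * Bv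
      * exp (-(μ * ∑ i, (((blk n p i - b₀ i).natAbs : ℕ) : ℝ))) := by
  have hgm : 0 < γ - μ := by linarith
  have hB : 0 ≤ Bv := by
    have h := (abs_nonneg _).trans (hv p)
    exact le_of_mul_le_mul_right (by rw [zero_mul]; exact h) (exp_pos _)
  have hpt : ∀ q, |K p q * v q| ≤ ε * exp (μ * d) * Bv * exp (-(μ * ∑ i, (((blk n p i - b₀ i).natAbs : ℕ) : ℝ)))
      * exp (-((γ - μ) * ∑ i, (((p i - q i).natAbs : ℕ) : ℝ))) := by
    intro q
    rw [abs_mul]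
    have e1 := hK p q; have e2 := hv q
    have htri := l1_triangle (blk n p) (blk n q) b₀
    have hbl := blockDist_le_l1 n p q
    have h3 : ε * exp (-(γ * ∑ i, (((p i - q i).natAbs : ℕ) : ℝ))) * (Bv * exp (-(μ * ∑ i, (((blk n q i - b₀ i).natAbs : ℕ) : ℝ))))
        ≤ ε * exp (μ * d) * Bv * exp (-(μ * ∑ i, (((blk n p i - b₀ i).natAbs : ℕ) : ℝ)))
          * exp (-((γ - μ) * ∑ i, (((p i - q i).natAbs : ℕ) : ℝ))) := by
      have h4 : exp (-(γ * ∑ i, (((p i - q i).natAbs : ℕ) : ℝ))) * exp (-(μ * ∑ i, (((blk n q i - b₀ i).natAbs : ℕ) : ℝ)))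
          ≤ exp (μ * d) * exp (-(μ * ∑ i, (((blk n p i - b₀ i).natAbs : ℕ) : ℝ))) * exp (-((γ - μ) * ∑ i, (((p i - q i).natAbs : ℕ) : ℝ))) := by
        rw [← exp_add, ← exp_add, ← exp_add]
        exact exp_le_exp.2 (by nlinarith)
      calc ε * exp (-(γ * ∑ i, (((p i - q i).natAbs : ℕ) : ℝ))) * (Bv * exp (-(μ * ∑ i, (((blk n q i - b₀ i).natAbs : ℕ) : ℝ))))
          = ε * Bv * (exp (-(γ * ∑ i, (((p i - q i).natAbs : ℕ) : ℝ))) * exp (-(μ * ∑ i, (((blk n q i - b₀ i).natAbs : ℕ) : ℝ)))) := by ring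
        _ ≤ ε * Bv * (exp (μ * d) * exp (-(μ * ∑ i, (((blk n p i - b₀ i).natAbs : ℕ) : ℝ)))
            * exp (-((γ - μ) * ∑ i, (((p i - q i).natAbs : ℕ) : ℝ)))) := mul_le_mul_of_nonneg_left h4 (by positivity)
        _ = _ := by ring
    exact (mul_le_mul e1 e2 (abs_nonneg _) (by positivity)).trans h3
  have hsum : Summable fun q : X d => ε * exp (μ * d) * Bv * exp (-(μ * ∑ i, (((blk n p i - b₀ i).natAbs : ℕ) : ℝ)))
      * exp (-((γ - μ) * ∑ i, (((p i - q i).natAbs : ℕ) : ℝ))) := (summable_exp_l1 hgm p).mul_left _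
  have hs : Summable fun q : X d => K p q * v q := Summable.of_norm_bounded hsum fun q => by rw [Real.norm_eq_abs]; exact hpt q
  refine ⟨hs, ?_⟩
  have h1 : |∑' q : X d, K p q * v q| ≤ ∑' q : X d, |K p q * v q| := by
    have := norm_tsum_le_tsum_norm hs.norm; simpa only [Real.norm_eq_abs] using this
  have h2 := hs.abs.tsum_le_tsum hpt hsum
  rw [(summable_exp_l1 hgm p).tsum_mul_left] at h2
  have h3 := mul_le_mul_of_nonneg_left (tsum_exp_l1_le hgm p)
    (show 0 ≤ ε * exp (μ * d) * Bv * exp (-(μ * ∑ i, (((blk n p i - b₀ i).natAbs : ℕ) : ℝ))) by positivity)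
  calc |∑' q : X d, K p q * v q| ≤ ε * exp (μ * d) * Bv * exp (-(μ * ∑ i, (((blk n p i - b₀ i).natAbs : ℕ) : ℝ)))
        * (2 * (1 - exp (-(γ - μ)))⁻¹) ^ d := h1.trans (h2.trans h3)
    _ = _ := by ring

/-! ## §2. The Neumann iterates keep the profile: `|u_j| ≤ C_PM·θ^j·e^{−μ|blk n · − b₀|₁}` -/

/-- **THE ITERATES' PROFILE**: with `G = H_V⁻¹ ∈ L(ℓ^∞)` ((188)'s displays), `K` of the class acting as `Kop`, and a no-loss profile bound
of constant `C_P` at rate `μ < γ` (hypothesis; (214) supplies it), the Neumann iterates `u_j = (−GK)^jGf` of a source of profile `M` satisfy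
`|u_j(p)| ≤ C_PM·(C_Pεe^{μd}K_{γ−μ})^j·e^{−μ|blk n p − b₀|₁}`. [folklore] -/
theorem neumann_iterates_profile (n : ℕ) {ε γ μ CP : ℝ} (hε : 0 ≤ ε) (hμ : 0 ≤ μ) (hμγ : μ < γ)
    (K : X d → X d → ℝ) (hK : ∀ p q, |K p q| ≤ ε * exp (-(γ * ∑ i, (((p i - q i).natAbs : ℕ) : ℝ))))
    (G Kop : lp (fun _ : X d => ℝ) ∞ →L[ℝ] lp (fun _ : X d => ℝ) ∞)
    (hKop : ∀ (v : lp (fun _ : X d => ℝ) ∞) (p : X d), Kop v p = ∑' q : X d, K p q * v q)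
    (b₀ : X d)
    (hprof : ∀ (Mg : ℝ) (g : lp (fun _ : X d => ℝ) ∞), (∀ p, |g p| ≤ Mg * exp (-(μ * ∑ i, (((blk n p i - b₀ i).natAbs : ℕ) : ℝ)))) →
      ∀ p, |G g p| ≤ CP * Mg * exp (-(μ * ∑ i, (((blk n p i - b₀ i).natAbs : ℕ) : ℝ))))
    (fl : lp (fun _ : X d => ℝ) ∞) (M : ℝ) (hf : ∀ p, |fl p| ≤ M * exp (-(μ * ∑ i, (((blk n p i - b₀ i).natAbs : ℕ) : ℝ))))
    (j : ℕ) : ∀ p : X d, |(((-(G.comp Kop)) ^ j) (G fl)) p|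
      ≤ CP * M * (CP * (ε * exp (μ * d) * (2 * (1 - exp (-(γ - μ)))⁻¹) ^ d)) ^ j
        * exp (-(μ * ∑ i, (((blk n p i - b₀ i).natAbs : ℕ) : ℝ))) := by
  induction j with
  | zero =>
    intro p
    rw [pow_zero, pow_zero, mul_one]
    exact hprof M fl hf p
  | succ j ih =>
    intro p
    -- `u_{j+1} = −G(K u_j)`
    obtain ⟨w, hw⟩ : ∃ w : lp (fun _ : X d => ℝ) ∞, w = ((-(G.comp Kop)) ^ j) (G fl) := ⟨_, rfl⟩
    have hstep : (((-(G.comp Kop)) ^ (j + 1)) (G fl)) p = -(G (Kop w) p) := by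
      rw [pow_succ', hw]
      rfl
    rw [hstep, abs_neg]
    -- the source `K u_j` has profile `εe^{μd}K_{γ−μ}·(C_PMθ^j)`
    have hv : ∀ q, |w q| ≤ CP * M * (CP * (ε * exp (μ * d) * (2 * (1 - exp (-(γ - μ)))⁻¹) ^ d)) ^ j
        * exp (-(μ * ∑ i, (((blk n q i - b₀ i).natAbs : ℕ) : ℝ))) := fun q => by rw [hw]; exact ih q
    have hsrc : ∀ q, |Kop w q| ≤ ε * exp (μ * d) * (2 * (1 - exp (-(γ - μ)))⁻¹) ^ d
        * (CP * M * (CP * (ε * exp (μ * d) * (2 * (1 - exp (-(γ - μ)))⁻¹) ^ d)) ^ j)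
        * exp (-(μ * ∑ i, (((blk n q i - b₀ i).natAbs : ℕ) : ℝ))) := fun q => by
      rw [hKop]; exact (kernel_profile_step n hε hμ hμγ K hK b₀ (fun q => w q) hv q).2
    refine (hprof _ (Kop w) hsrc p).trans (le_of_eq ?_)
    ring

/-! ## §3. The Neumann series solves the perturbed equation (pure bookkeeping on `ℕ × ℤ^d`) -/

/-- **THE SERIES OF THE ITERATES**: if `|u_j(q)| ≤ Bθ^je^{−μ|blk n q − b₀|₁}` with `0 ≤ θ ≤ 1∕2`, `H_Vu₀ = f` and `H_Vu_{j+1} = −Ku_j`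
(`|K(p,q)| ≤ εe^{−γ|p−q|₁}`, `γ > 0`), then `u = Σ_ju_j` converges absolutely at every point, `|u(q)| ≤ 2Be^{−μ|blk n q − b₀|₁}`, and
`H_Vu + Σ′_qK(·,q)u(q) = f` — the finite stencil through `Σ_j`, the kernel rows through `Σ_j` by Fubini on `ℕ × ℤ^d` (domination
`Bθ^j·εe^{−γ|q−q′|₁}`), and `Σ_j = (j = 0) + Σ_j(j+1)`. [folklore] -/
theorem neumann_series_solves (n : ℕ) (a : ℝ) (V : X d → ℝ) {ε γ μ Bz θ : ℝ} (hε : 0 ≤ ε) (hγ : 0 < γ) (hμ : 0 ≤ μ) (hB : 0 ≤ Bz)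
    (hθ0 : 0 ≤ θ) (hθ1 : θ ≤ 1 / 2)
    (K : X d → X d → ℝ) (hK : ∀ p q, |K p q| ≤ ε * exp (-(γ * ∑ i, (((p i - q i).natAbs : ℕ) : ℝ)))) (b₀ : X d) (f : X d → ℝ)
    (useq : ℕ → X d → ℝ) (hiter : ∀ j q, |useq j q| ≤ Bz * θ ^ j * exp (-(μ * ∑ i, (((blk n q i - b₀ i).natAbs : ℕ) : ℝ))))
    (hrec0 : ∀ q, ((n : ℝ) + 1) ^ 2 * ∑ μ', (2 * useq 0 q - useq 0 (q + e μ') - useq 0 (q - e μ'))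
      + a / ((n : ℝ) + 1) ^ d * ∑ q' ∈ B n (blk n q), useq 0 q' + V q * useq 0 q = f q)
    (hrecS : ∀ j q, ((n : ℝ) + 1) ^ 2 * ∑ μ', (2 * useq (j + 1) q - useq (j + 1) (q + e μ') - useq (j + 1) (q - e μ'))
      + a / ((n : ℝ) + 1) ^ d * ∑ q' ∈ B n (blk n q), useq (j + 1) q' + V q * useq (j + 1) q = -(∑' q' : X d, K q q' * useq j q')) :
    (∀ q, Summable fun j : ℕ => useq j q) ∧
    (∀ q, |∑' j : ℕ, useq j q| ≤ 2 * Bz * exp (-(μ * ∑ i, (((blk n q i - b₀ i).natAbs : ℕ) : ℝ)))) ∧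
    (∀ q, ((n : ℝ) + 1) ^ 2 * ∑ μ', (2 * (∑' j : ℕ, useq j q) - (∑' j : ℕ, useq j (q + e μ')) - (∑' j : ℕ, useq j (q - e μ')))
      + a / ((n : ℝ) + 1) ^ d * ∑ q' ∈ B n (blk n q), (∑' j : ℕ, useq j q') + V q * (∑' j : ℕ, useq j q)
      + ∑' q' : X d, K q q' * ∑' j : ℕ, useq j q' = f q) := by
  classical
  have hθlt : θ < 1 := by linarith
  have hgeom := summable_geometric_of_lt_one hθ0 hθlt
  have hsj : ∀ q, Summable fun j : ℕ => useq j q := fun q =>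
    Summable.of_norm_bounded ((hgeom.mul_left Bz).mul_right _) fun j => by rw [Real.norm_eq_abs]; exact hiter j q
  have hustar : ∀ q, |∑' j : ℕ, useq j q| ≤ 2 * Bz * exp (-(μ * ∑ i, (((blk n q i - b₀ i).natAbs : ℕ) : ℝ))) := by
    intro q
    have h1 : |∑' j : ℕ, useq j q| ≤ ∑' j : ℕ, |useq j q| := by
      have := norm_tsum_le_tsum_norm (hsj q).norm; simpa only [Real.norm_eq_abs] using this
    have hgs := (hgeom.mul_left Bz).mul_right (exp (-(μ * ∑ i, (((blk n q i - b₀ i).natAbs : ℕ) : ℝ))))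
    have h2 := (hsj q).abs.tsum_le_tsum (hiter · q) hgs
    have h3 : ∑' j : ℕ, Bz * θ ^ j * exp (-(μ * ∑ i, (((blk n q i - b₀ i).natAbs : ℕ) : ℝ)))
        = Bz * (∑' j : ℕ, θ ^ j) * exp (-(μ * ∑ i, (((blk n q i - b₀ i).natAbs : ℕ) : ℝ))) := by
      rw [← tsum_mul_left, ← tsum_mul_right]
    have h4 : ∑' j : ℕ, θ ^ j ≤ 2 := by
      rw [tsum_geometric_of_lt_one hθ0 hθlt]
      calc (1 - θ)⁻¹ ≤ (1 / 2 : ℝ)⁻¹ := inv_anti₀ (by norm_num) (by linarith)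
        _ = 2 := by norm_num
    rw [h3] at h2
    have h5 : Bz * (∑' j : ℕ, θ ^ j) * exp (-(μ * ∑ i, (((blk n q i - b₀ i).natAbs : ℕ) : ℝ)))
        ≤ Bz * 2 * exp (-(μ * ∑ i, (((blk n q i - b₀ i).natAbs : ℕ) : ℝ))) :=
      mul_le_mul_of_nonneg_right (mul_le_mul_of_nonneg_left h4 hB) (exp_pos _).le
    calc |∑' j : ℕ, useq j q| ≤ Bz * 2 * exp (-(μ * ∑ i, (((blk n q i - b₀ i).natAbs : ℕ) : ℝ))) := h1.trans (h2.trans h5)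
      _ = _ := by ring
  refine ⟨hsj, hustar, fun q => ?_⟩
  -- the kernel rows through `Σ_j`: Fubini on `ℕ × ℤ^d`
  obtain ⟨F, hF⟩ : ∃ F : ℕ → X d → ℝ, ∀ j q', F j q' = K q q' * useq j q' := ⟨_, fun _ _ => rfl⟩
  have hdom : ∀ j q', |F j q'| ≤ (Bz * θ ^ j) * (ε * exp (-(γ * ∑ i, (((q i - q' i).natAbs : ℕ) : ℝ)))) := by
    intro j q'
    rw [hF, abs_mul, mul_comm]
    refine mul_le_mul ((hiter j q').trans ?_) (hK q q') (abs_nonneg _) (mul_nonneg hB (pow_nonneg hθ0 j))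
    exact mul_le_of_le_one_right (mul_nonneg hB (pow_nonneg hθ0 j)) (exp_le_one_iff.2 (neg_nonpos.2 (by positivity)))
  have hprod : Summable fun x : ℕ × X d => (Bz * θ ^ x.1) * (ε * exp (-(γ * ∑ i, (((q i - x.2 i).natAbs : ℕ) : ℝ)))) :=
    Summable.mul_of_nonneg (hgeom.mul_left Bz) ((summable_exp_l1 hγ q).mul_left ε)
      (fun j => mul_nonneg hB (pow_nonneg hθ0 j)) (fun q' => by positivity)
  have hFsum : Summable (Function.uncurry F) :=
    Summable.of_norm_bounded hprod fun x => by simp only [Function.uncurry, Real.norm_eq_abs]; exact hdom x.1 x.2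
  have hinner : ∀ q', ∑' j : ℕ, F j q' = K q q' * ∑' j : ℕ, useq j q' := fun q' => by
    simp only [hF]; rw [tsum_mul_left]
  have hKrow : ∑' q' : X d, K q q' * ∑' j : ℕ, useq j q' = ∑' j : ℕ, ∑' q' : X d, F j q' := by
    rw [show (fun q' : X d => K q q' * ∑' j : ℕ, useq j q') = fun q' => ∑' j : ℕ, F j q' from funext fun q' => (hinner q').symm]
    exact hFsum.tsum_comm
  -- the stencil through `Σ_j`
  have hS1 : ∀ μ' : Fin d, Summable fun j : ℕ => 2 * useq j q - useq j (q + e μ') - useq j (q - e μ') :=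
    fun μ' => (((hsj q).mul_left 2).sub (hsj (q + e μ'))).sub (hsj (q - e μ'))
  have hS1s : Summable fun j : ℕ => ∑ μ', (2 * useq j q - useq j (q + e μ') - useq j (q - e μ')) := summable_sum fun μ' _ => hS1 μ'
  have hS2 : Summable fun j : ℕ => ∑ q' ∈ B n (blk n q), useq j q' := summable_sum fun q' _ => hsj q'
  have hT1 : ∑' j : ℕ, ∑ μ', (2 * useq j q - useq j (q + e μ') - useq j (q - e μ'))
      = ∑ μ', (2 * (∑' j : ℕ, useq j q) - (∑' j : ℕ, useq j (q + e μ')) - (∑' j : ℕ, useq j (q - e μ'))) := by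
    rw [Summable.tsum_finsetSum fun μ' _ => hS1 μ']
    refine Finset.sum_congr rfl fun μ' _ => ?_
    rw [(((hsj q).mul_left 2).sub (hsj (q + e μ'))).tsum_sub (hsj (q - e μ')), ((hsj q).mul_left 2).tsum_sub (hsj (q + e μ')),
      (hsj q).tsum_mul_left 2]
  have hT2 : ∑' j : ℕ, ∑ q' ∈ B n (blk n q), useq j q' = ∑ q' ∈ B n (blk n q), ∑' j : ℕ, useq j q' :=
    Summable.tsum_finsetSum fun q' _ => hsj q'
  have hHsum : Summable fun j : ℕ => ((n : ℝ) + 1) ^ 2 * ∑ μ', (2 * useq j q - useq j (q + e μ') - useq j (q - e μ'))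
      + a / ((n : ℝ) + 1) ^ d * ∑ q' ∈ B n (blk n q), useq j q' + V q * useq j q :=
    ((hS1s.mul_left _).add (hS2.mul_left _)).add ((hsj q).mul_left _)
  have hmain : ∑' j : ℕ, (((n : ℝ) + 1) ^ 2 * ∑ μ', (2 * useq j q - useq j (q + e μ') - useq j (q - e μ'))
      + a / ((n : ℝ) + 1) ^ d * ∑ q' ∈ B n (blk n q), useq j q' + V q * useq j q)
      = ((n : ℝ) + 1) ^ 2 * ∑' j : ℕ, ∑ μ', (2 * useq j q - useq j (q + e μ') - useq j (q - e μ'))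
        + a / ((n : ℝ) + 1) ^ d * ∑' j : ℕ, ∑ q' ∈ B n (blk n q), useq j q' + V q * ∑' j : ℕ, useq j q := by
    rw [Summable.tsum_add ((hS1s.mul_left _).add (hS2.mul_left _)) ((hsj q).mul_left _),
      Summable.tsum_add (hS1s.mul_left _) (hS2.mul_left _), hS1s.tsum_mul_left (((n : ℝ) + 1) ^ 2),
      hS2.tsum_mul_left (a / ((n : ℝ) + 1) ^ d), (hsj q).tsum_mul_left (V q)]
  -- split off `j = 0` and read the recursion
  have hsplit := hHsum.tsum_eq_zero_add
  rw [hrec0 q] at hsplit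
  simp only [hrecS] at hsplit
  have hKs : Summable fun j : ℕ => ∑' q' : X d, F j q' := hFsum.prod
  have hKs' : ∑' j : ℕ, -(∑' q' : X d, K q q' * useq j q') = -(∑' j : ℕ, ∑' q' : X d, F j q') := by
    rw [← tsum_neg]; exact tsum_congr fun j => by simp only [hF]
  rw [hKs'] at hsplit
  rw [← hT1, ← hT2, ← hmain, hsplit, hKrow]
  ring

/-! ## §4. THE END: the decay of `(H_V + K)⁻¹` on block sources -/

/-- **HEADLINE — THE PERTURBED PROPAGATOR DECAYS ON `ℤ^d`**: `d ≥ 3`, `a > 0`, `λ < min(2,a)`, `Λ ≥ 0` ⟹ `∃ C₀ C_P δ₀ > 0` (from `(d, a, λ, Λ)`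
ONLY: (213)'s smallness scale, (214)'s no-loss constant and (180)'s rate) such that for ALL `n`, `V : ℤ^d → [−λ, Λ]`, every `ε ≥ 0`, rates
`0 < μ < min(δ₀, γ)`, under the two smallness conditions `εK_γC₀ ≤ 1∕2` ((213)) and `(C_PK_{δ₀−μ})·εe^{μd}K_{γ−μ} ≤ 1∕2` (contraction of
the profile), every kernel `|K(p,q)| ≤ εe^{−γ|p−q|₁}`, every source `f` supported in the block `b₀` with `|f| ≤ M`, and EVERY bounded
solution `u` of `H_Vu + Σ′_qK(·,q)u(q) = f`: `|u(p)| ≤ 2C_PK_{δ₀−μ}·M·e^{−μ|blk n p − b₀|₁}` — the Neumann iterates keep the profile (§2), their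
series solves the equation (§3) and is THE bounded solution ((213)). [folklore] -/
theorem zd_perturbed_decay (hd : 3 ≤ d) (a : ℝ) (ha : 0 < a) {lam Lam : ℝ} (hlam : lam < min 2 a) (hLam : 0 ≤ Lam) :
    ∃ C₀ CP δ₀ : ℝ, 0 < C₀ ∧ 0 < CP ∧ 0 < δ₀ ∧ ∀ (n : ℕ) (V : X d → ℝ), (∀ p, -lam ≤ V p) → (∀ p, V p ≤ Lam) →
      ∀ (ε γ μ : ℝ), 0 ≤ ε → 0 < μ → μ < δ₀ → μ < γ →
      ε * (2 * (1 - exp (-γ))⁻¹) ^ d * C₀ ≤ 1 / 2 →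
      (CP * (2 * (1 - exp (-(δ₀ - μ)))⁻¹) ^ d) * (ε * exp (μ * d) * (2 * (1 - exp (-(γ - μ)))⁻¹) ^ d) ≤ 1 / 2 →
      ∀ (K : X d → X d → ℝ), (∀ p q, |K p q| ≤ ε * exp (-(γ * ∑ i, (((p i - q i).natAbs : ℕ) : ℝ)))) →
      ∀ (b₀ : X d) (M : ℝ) (f : X d → ℝ), (∀ p, blk n p ≠ b₀ → f p = 0) → (∀ p, |f p| ≤ M) →
      ∀ (u : X d → ℝ) (Bu : ℝ), (∀ p, |u p| ≤ Bu) →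
      (∀ p, ((n : ℝ) + 1) ^ 2 * ∑ μ', (2 * u p - u (p + e μ') - u (p - e μ'))
        + a / ((n : ℝ) + 1) ^ d * ∑ q ∈ B n (blk n p), u q + V p * u p + ∑' q : X d, K p q * u q = f p) →
      ∀ p, |u p| ≤ 2 * (CP * (2 * (1 - exp (-(δ₀ - μ)))⁻¹) ^ d) * M * exp (-(μ * ∑ i, (((blk n p i - b₀ i).natAbs : ℕ) : ℝ))) := by
  classical
  obtain ⟨C₀, hC₀, H213⟩ := zd_perturbed_inverse_clm (d := d) hd a ha hlam hLam
  obtain ⟨CP, δ₀, hCP, hδ₀, H214⟩ := zd_profile_noLoss (d := d) hd a ha hlam hLam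
  obtain ⟨Cg, hCg, H188⟩ := exists_zd_propagator_clm (d := d) hd a ha hlam hLam
  refine ⟨C₀, CP, δ₀, hC₀, hCP, hδ₀, ?_⟩
  intro n V hV hV' ε γ μ hε hμ hμδ hμγ hsmall1 hsmall2 K hK b₀ M f hf0 hfM u Bu huB hu p
  have hγ : 0 < γ := lt_trans hμ hμγ
  have hM : 0 ≤ M := (abs_nonneg _).trans (hfM p)
  have hKδμ : 0 < (2 * (1 - exp (-(δ₀ - μ)))⁻¹) ^ d := pow_pos (mul_pos two_pos (inv_pos.2 (sub_pos.2 (exp_lt_one_iff.2 (by linarith))))) d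
  have hKγμ : 0 < (2 * (1 - exp (-(γ - μ)))⁻¹) ^ d := pow_pos (mul_pos two_pos (inv_pos.2 (sub_pos.2 (exp_lt_one_iff.2 (by linarith))))) d
  obtain ⟨CPK, hCPK⟩ : ∃ CPK : ℝ, CPK = CP * (2 * (1 - exp (-(δ₀ - μ)))⁻¹) ^ d := ⟨_, rfl⟩
  have hCPK0 : 0 < CPK := by rw [hCPK]; exact mul_pos hCP hKδμ
  obtain ⟨θ, hθ⟩ : ∃ θ : ℝ, θ = CPK * (ε * exp (μ * d) * (2 * (1 - exp (-(γ - μ)))⁻¹) ^ d) := ⟨_, rfl⟩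
  have hθ0 : 0 ≤ θ := by rw [hθ]; exact mul_nonneg hCPK0.le (mul_nonneg (mul_nonneg hε (exp_pos _).le) hKγμ.le)
  have hθ1 : θ ≤ 1 / 2 := by rw [hθ, hCPK]; exact hsmall2
  obtain ⟨G, -, hGeq, -⟩ := H188 n V hV hV'
  obtain ⟨Kop, -, hKop⟩ := kernel_clm (d := d) hε hγ K hK
  obtain ⟨GK, -, -, hGKuniq⟩ := H213 n V hV hV' ε γ hε hγ hsmall1 K hK
  -- the source as an element of `ℓ^∞`, with profile `M` at rate `μ`
  have hfmem : Memℓp f ∞ := memℓp_infty ⟨M, by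
    rintro _ ⟨q, rfl⟩
    show ‖f q‖ ≤ M
    rw [Real.norm_eq_abs]; exact hfM q⟩
  obtain ⟨fl, hfl⟩ : ∃ fl : lp (fun _ : X d => ℝ) ∞, ∀ q, fl q = f q := ⟨⟨f, hfmem⟩, fun _ => rfl⟩
  have hfprof : ∀ q, |fl q| ≤ M * exp (-(μ * ∑ i, (((blk n q i - b₀ i).natAbs : ℕ) : ℝ))) := by
    intro q
    rw [hfl]
    by_cases hq : blk n q = b₀
    · rw [hq]; simp only [sub_self, Int.natAbs_zero, Nat.cast_zero, Finset.sum_const_zero, mul_zero, neg_zero, exp_zero, mul_one]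
      exact hfM q
    · rw [hf0 q hq, abs_zero]; positivity
  -- (214) as the profile hypothesis of §2
  have hprof : ∀ (Mg : ℝ) (g : lp (fun _ : X d => ℝ) ∞), (∀ q, |g q| ≤ Mg * exp (-(μ * ∑ i, (((blk n q i - b₀ i).natAbs : ℕ) : ℝ)))) →
      ∀ q, |G g q| ≤ CPK * Mg * exp (-(μ * ∑ i, (((blk n q i - b₀ i).natAbs : ℕ) : ℝ))) := fun Mg g hg q => by
    have h := H214 n V hV hV' μ hμ hμδ b₀ Mg (fun q => g q) hg (fun q => G g q) ‖G g‖ (fun q => abs_apply_le_norm (G g) q) (hGeq g) q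
    rw [hCPK]
    calc |G g q| ≤ CP * (2 * (1 - exp (-(δ₀ - μ)))⁻¹) ^ d * Mg * exp (-(μ * ∑ i, (((blk n q i - b₀ i).natAbs : ℕ) : ℝ))) := h
      _ = _ := by ring
  -- the iterates, their profile (§2) and their recursion
  obtain ⟨useq, huseq⟩ : ∃ useq : ℕ → X d → ℝ, ∀ j q, useq j q = (((-(G.comp Kop)) ^ j) (G fl)) q := ⟨_, fun _ _ => rfl⟩
  have hiter : ∀ j q, |useq j q| ≤ CPK * M * θ ^ j * exp (-(μ * ∑ i, (((blk n q i - b₀ i).natAbs : ℕ) : ℝ))) := by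
    intro j q
    rw [huseq, hθ]
    exact neumann_iterates_profile n hε hμ.le hμγ K hK G Kop hKop b₀ hprof fl M hfprof j q
  have hrec0 : ∀ q, ((n : ℝ) + 1) ^ 2 * ∑ μ', (2 * useq 0 q - useq 0 (q + e μ') - useq 0 (q - e μ'))
      + a / ((n : ℝ) + 1) ^ d * ∑ q' ∈ B n (blk n q), useq 0 q' + V q * useq 0 q = f q := by
    intro q
    have e0 : ∀ q', useq 0 q' = G fl q' := fun q' => by rw [huseq, pow_zero]; rfl
    simp only [e0]
    rw [← hfl]; exact hGeq fl q
  have hrecS : ∀ j q, ((n : ℝ) + 1) ^ 2 * ∑ μ', (2 * useq (j + 1) q - useq (j + 1) (q + e μ') - useq (j + 1) (q - e μ'))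
      + a / ((n : ℝ) + 1) ^ d * ∑ q' ∈ B n (blk n q), useq (j + 1) q' + V q * useq (j + 1) q = -(∑' q' : X d, K q q' * useq j q') := by
    intro j q
    obtain ⟨w, hw⟩ : ∃ w : lp (fun _ : X d => ℝ) ∞, w = ((-(G.comp Kop)) ^ j) (G fl) := ⟨_, rfl⟩
    have hwq : ∀ q', w q' = useq j q' := fun q' => by rw [hw, huseq]
    have eS : ∀ q', useq (j + 1) q' = -(G (Kop w) q') := fun q' => by
      rw [huseq, pow_succ', hw]
      rfl
    simp only [eS]
    have h := hGeq (Kop w) q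
    rw [hKop] at h
    simp only [hwq] at h
    rw [← h]
    have e1 : ∑ μ', (2 * -(G (Kop w) q) - -(G (Kop w) (q + e μ')) - -(G (Kop w) (q - e μ')))
        = -∑ μ', (2 * G (Kop w) q - G (Kop w) (q + e μ') - G (Kop w) (q - e μ')) := by
      rw [← Finset.sum_neg_distrib]; exact Finset.sum_congr rfl fun μ' _ => by ring
    rw [e1, Finset.sum_neg_distrib]
    ring
  -- §3: the series is a bounded solution with the profile
  obtain ⟨-, hbound, heqn⟩ := neumann_series_solves n a V hε hγ hμ.le (mul_nonneg hCPK0.le hM) hθ0 hθ1 K hK b₀ f useq hiter hrec0 hrecS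
  have hstarB : ∀ q, |∑' j : ℕ, useq j q| ≤ 2 * (CPK * M) := fun q =>
    (hbound q).trans (mul_le_of_le_one_right (by positivity) (exp_le_one_iff.2 (neg_nonpos.2 (by positivity))))
  -- (213): both `u` and the series are `G_Kf`
  have hu' : ∀ q, ((n : ℝ) + 1) ^ 2 * ∑ μ', (2 * u q - u (q + e μ') - u (q - e μ'))
      + a / ((n : ℝ) + 1) ^ d * ∑ q' ∈ B n (blk n q), u q' + V q * u q + ∑' q' : X d, K q q' * u q' = fl q := fun q => by
    rw [hfl]; exact hu q
  have hstar' : ∀ q, ((n : ℝ) + 1) ^ 2 * ∑ μ', (2 * (∑' j : ℕ, useq j q) - (∑' j : ℕ, useq j (q + e μ')) - (∑' j : ℕ, useq j (q - e μ')))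
      + a / ((n : ℝ) + 1) ^ d * ∑ q' ∈ B n (blk n q), (∑' j : ℕ, useq j q') + V q * (∑' j : ℕ, useq j q)
      + ∑' q' : X d, K q q' * ∑' j : ℕ, useq j q' = fl q := fun q => by rw [hfl]; exact heqn q
  have h1 := hGKuniq fl u Bu huB hu' p
  have h2 := hGKuniq fl (fun q => ∑' j : ℕ, useq j q) (2 * (CPK * M)) hstarB hstar' p
  rw [h1, ← h2]
  calc |∑' j : ℕ, useq j p| ≤ 2 * (CPK * M) * exp (-(μ * ∑ i, (((blk n p i - b₀ i).natAbs : ℕ) : ℝ))) := hbound p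
    _ = _ := by rw [hCPK]; ring

/-! ## §5. Toy -/

/-- Toy (`d = 2`, `n = 3`): blocks are `1`-Lipschitz up to the dimension. -/
example (p q : X 2) : ∑ i, (((blk 3 p i - blk 3 q i).natAbs : ℕ) : ℝ) ≤ ∑ i, (((p i - q i).natAbs : ℕ) : ℝ) + 2 := by
  have h := blockDist_le_l1 (d := 2) 3 p q
  norm_num at h ⊢
  exact h

end Summit.QuantumFields.BalabanUV.T4Continuum.NE7b.SupZdPerturbedDecay
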